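import Mathlib
import Summits.MatrixMultiplication.MatrixMultiplication.Theorems.SnSubsetDichotomyNoThresholdSubsetTriplePlancherelGrowthDefs
import Summits.MatrixMultiplication.MatrixMultiplication.Theorems.SnSubsetDichotomyNoThresholdSubsetTriplePairMeasureBasic
import Summits.MatrixMultiplication.MatrixMultiplication.Theorems.SnSubsetDichotomyNoThresholdSubsetTripleBlockSucc
import Summits.MatrixMultiplication.MatrixMultiplication.Theorems.SnSubsetDichotomyNoThresholdSubsetTripleShapeBeforeDefs
import Summits.MatrixMultiplication.MatrixMultiplication.Theorems.SnSubsetDichotomyNoThresholdSubsetTriplePlancherelStepDefs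

/-!
# The model theorem: the Plancherel kernel is the conditional law of the next shape

Line `klr-graded-polynomial-method`, crux `SnSubsetDichotomy.NoThresholdSubsetTriple` (stmt-MatrixMultiplication-8302),
stub `condExp_prefix_succ` (THE MODEL THEOREM).

On the finite probability space `TableauPair n` (same-shape pairs `ω = (λ, S, T)` of standard Young tableaux with `n`
cells, discrete σ-algebra, uniform measure `pairMeasure n = (n!)⁻¹ • count`) with the prefix filtration
`ℱ_t = comap (prefixKey n t) ⊤` (generated by the cells of the entries `< t` of the second tableau `T`), the prefix
shapes `ν_t(ω) = shapeBefore T t` form a Markov chain with the Plancherel kernel: for every `t < n` and every test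
function `φ`,

`E[φ(ν_{t+1}) | ℱ_t](ω) = ∑_{z addable in ν_t(ω)} transProb (ν_t ω) z · φ(ν_t(ω) ∪ {z})`  a.e.

Proof.  Uniqueness of the conditional expectation (`ae_eq_condExp_of_forall_setIntegral_eq`): the right-hand side is a
function of `ν_t`, hence `ℱ_t`-measurable (`pairMeasure_basic`); every `ℱ_t`-measurable set is a union of prefix blocks
`{ω | prefixKey n t ω = prefixKey n t ω₀}`, set integrals against `(n!)⁻¹ • count` are finite sums, and on one block
both sums equal `#block · ∑_z p_z φ(Y ∪ z)`, `Y = ν_t(ω₀)`: the right-hand side is constant there, and on the left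
`ν_{t+1}(ω) = Y ∪ {T t}` (`shapeBefore_api`) with `#{ω ∈ block | T t = z} = p_z · #block` for each addable `z`
(`block_succ_card`, the hook length formula).
-/

open MeasureTheory ProbabilityTheory
open scoped BigOperators ENNReal
open Literature.RepresentationTheory.FiniteGroups (addableNodes IsAddableNode TableauPair)
open Literature.NumberTheory.DiophantineGeometry (StdFilling)

namespace Summit.MatrixMultiplication.MatrixMultiplication.Theorems

open PlancherelStep PlancherelGrowth

/-! ### The prefix shape on a prefix block -/

-- `Summit.<Summit>.<Problem>`: the two namespace components coincide for this single-conjunct summit.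
set_option linter.dupNamespace false in
/-- The prefix shape is a function of the prefix key: the cells of the entries `< t` of the second tableau are the
values `some _` of `prefixKey n t ω`. -/
private theorem shapeBefore_eq_biUnion_prefixKey {n : ℕ} (t : ℕ) (ω : TableauPair n) :
    shapeBefore (ω.2.2).1 t = Finset.univ.biUnion fun k => (prefixKey n t ω k).toFinset := by
  -- adapted from `SnSubsetDichotomyNoThresholdSubsetTriplePairMeasureBasic` (same namespace, private there)
  ext x
  simp only [shapeBefore, Finset.mem_image, Finset.mem_filter, Finset.mem_univ, true_and, Finset.mem_biUnion,
    Option.mem_toFinset, Option.mem_def, prefixKey, Option.ite_none_right_eq_some, Option.some.injEq]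

set_option linter.dupNamespace false in
/-- Two pairs with the same prefix key at time `t` have the same prefix shape at time `t`. -/
private theorem shapeBefore_eq_of_prefixKey_eq {n t : ℕ} {ω ω₀ : TableauPair n}
    (h : prefixKey n t ω = prefixKey n t ω₀) : shapeBefore (ω.2.2).1 t = shapeBefore (ω₀.2.2).1 t := by
  rw [shapeBefore_eq_biUnion_prefixKey t ω, shapeBefore_eq_biUnion_prefixKey t ω₀, h]

set_option linter.dupNamespace false in
/-- The growth step of the second tableau: `ν_{t+1} = ν_t ∪ {T t}` (`shapeBefore_api`). -/
private theorem shapeBefore_succ_eq_insert {n t : ℕ} (ht : t < n) (ω : TableauPair n) :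
    shapeBefore (ω.2.2).1 (t + 1) = insert ((ω.2.2).1 ⟨t, ht⟩) (shapeBefore (ω.2.2).1 t) :=
  (shapeBefore_api n _ ω.2.2 ω.1.card_cells_youngDiagram).2.1 t ht

set_option linter.dupNamespace false in
/-- The cell of the entry `t` of the second tableau is an addable node of the prefix shape `ν_t` (`shapeBefore_api`). -/
private theorem apply_mem_addableNodes_shapeBefore {n t : ℕ} (ht : t < n) (ω : TableauPair n) :
    (ω.2.2).1 ⟨t, ht⟩ ∈ addableNodes (shapeBefore (ω.2.2).1 t) :=
  (shapeBefore_api n _ ω.2.2 ω.1.card_cells_youngDiagram).2.2.2.2 t ht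

/-! ### The finite-sum identity on a prefix block and on a union of prefix blocks -/

set_option linter.dupNamespace false in
/-- **One block.**  On the prefix block `B` of `ω₀` at time `t` (`Y₀ = ν_t(ω₀)` the common prefix shape),
`∑_{ω ∈ B} φ(ν_{t+1} ω) = ∑_{ω ∈ B} ∑_z p_{ν_t ω}(z) φ(ν_t ω ∪ z)`: the right-hand side is
`#B · ∑_z p_{Y₀}(z) φ(Y₀ ∪ z)`, and grouping the left-hand side by the cell `z = T t ∈ addableNodes Y₀` gives
`∑_z #{ω ∈ B | T t = z} · φ(Y₀ ∪ z)` with `#{ω ∈ B | T t = z} = p_{Y₀}(z) · #B` (`block_succ_card`). -/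
private theorem block_sum_eq {n t : ℕ} (ht : t < n) (φ : Finset (ℕ × ℕ) → ℝ) (ω₀ : TableauPair n)
    (B : Finset (TableauPair n)) (hB : ∀ ω, ω ∈ B ↔ prefixKey n t ω = prefixKey n t ω₀) :
    ∑ ω ∈ B, φ (shapeBefore (ω.2.2).1 (t + 1)) =
      ∑ ω ∈ B, ∑ z ∈ addableNodes (shapeBefore (ω.2.2).1 t),
        transProb (shapeBefore (ω.2.2).1 t) z * φ (insert z (shapeBefore (ω.2.2).1 t)) := by
  -- the common prefix shape `Y₀` of the block
  obtain ⟨Y₀, hY₀⟩ : ∃ Y₀, shapeBefore (ω₀.2.2).1 t = Y₀ := ⟨_, rfl⟩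
  have hY : ∀ ω ∈ B, shapeBefore (ω.2.2).1 t = Y₀ := fun ω hω =>
    (shapeBefore_eq_of_prefixKey_eq ((hB ω).1 hω)).trans hY₀
  have hmaps : ∀ ω ∈ B, (ω.2.2).1 ⟨t, ht⟩ ∈ addableNodes Y₀ := fun ω hω =>
    hY ω hω ▸ apply_mem_addableNodes_shapeBefore ht ω
  -- the two block counts, as `Finset` cardinalities
  have hcardBz : ∀ z ∈ addableNodes Y₀,
      (((B.filter fun ω => (ω.2.2).1 ⟨t, ht⟩ = z).card : ℕ) : ℝ) = transProb Y₀ z * (B.card : ℝ) := by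
    intro z hz
    have h1 : Nat.card {ω : TableauPair n // prefixKey n t ω = prefixKey n t ω₀ ∧ (ω.2.2).1 ⟨t, ht⟩ = z} =
        (B.filter fun ω => (ω.2.2).1 ⟨t, ht⟩ = z).card :=
      Nat.subtype_card _ fun ω => by rw [Finset.mem_filter, hB]
    have h2 : Nat.card {ω : TableauPair n // prefixKey n t ω = prefixKey n t ω₀} = B.card :=
      Nat.subtype_card _ hB
    have hz' : z ∈ addableNodes (shapeBefore (ω₀.2.2).1 t) := by rw [hY₀]; exact hz
    have h3 := block_succ_card n t ht ω₀ z hz'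
    rw [h1, h2, hY₀] at h3
    exact h3
  calc ∑ ω ∈ B, φ (shapeBefore (ω.2.2).1 (t + 1))
      = ∑ ω ∈ B, φ (insert ((ω.2.2).1 ⟨t, ht⟩) Y₀) :=
        Finset.sum_congr rfl fun ω hω => by rw [shapeBefore_succ_eq_insert ht ω, hY ω hω]
    _ = ∑ z ∈ addableNodes Y₀, ∑ ω ∈ B with (ω.2.2).1 ⟨t, ht⟩ = z, φ (insert z Y₀) :=
        (Finset.sum_fiberwise_of_maps_to' hmaps fun z => φ (insert z Y₀)).symm
    _ = ∑ z ∈ addableNodes Y₀, transProb Y₀ z * (B.card : ℝ) * φ (insert z Y₀) :=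
        Finset.sum_congr rfl fun z hz => by rw [Finset.sum_const, nsmul_eq_mul, hcardBz z hz]
    _ = (B.card : ℝ) * ∑ z ∈ addableNodes Y₀, transProb Y₀ z * φ (insert z Y₀) := by
        rw [Finset.mul_sum]
        exact Finset.sum_congr rfl fun z _ => by ring
    _ = ∑ _ω ∈ B, ∑ z ∈ addableNodes Y₀, transProb Y₀ z * φ (insert z Y₀) := by
        rw [Finset.sum_const, nsmul_eq_mul]
    _ = _ := Finset.sum_congr rfl fun ω hω => by rw [hY ω hω]

set_option linter.dupNamespace false in
/-- **A union of blocks.**  On a finite set `S` of pairs saturated for the prefix key (a union of prefix blocks), the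
sums of `φ(ν_{t+1})` and of `∑_z p_{ν_t}(z) φ(ν_t ∪ z)` agree: split both by the value of the key and use
`block_sum_eq` on each block. -/
private theorem sum_saturated_eq {n t : ℕ} (ht : t < n) (φ : Finset (ℕ × ℕ) → ℝ) (S : Finset (TableauPair n))
    (hS : ∀ ω ω₀, ω₀ ∈ S → prefixKey n t ω = prefixKey n t ω₀ → ω ∈ S) :
    ∑ ω ∈ S, φ (shapeBefore (ω.2.2).1 (t + 1)) =
      ∑ ω ∈ S, ∑ z ∈ addableNodes (shapeBefore (ω.2.2).1 t),
        transProb (shapeBefore (ω.2.2).1 t) z * φ (insert z (shapeBefore (ω.2.2).1 t)) := by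
  classical
  have hmaps : ∀ ω ∈ S, prefixKey n t ω ∈ S.image (prefixKey n t) := fun ω hω =>
    Finset.mem_image_of_mem _ hω
  rw [← Finset.sum_fiberwise_of_maps_to hmaps (fun ω => φ (shapeBefore (ω.2.2).1 (t + 1))),
    ← Finset.sum_fiberwise_of_maps_to hmaps (fun ω => ∑ z ∈ addableNodes (shapeBefore (ω.2.2).1 t),
      transProb (shapeBefore (ω.2.2).1 t) z * φ (insert z (shapeBefore (ω.2.2).1 t)))]
  refine Finset.sum_congr rfl fun κ hκ => ?_
  obtain ⟨ω₀, hω₀, rfl⟩ := Finset.mem_image.1 hκ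
  exact block_sum_eq ht φ ω₀ _ fun ω => by
    rw [Finset.mem_filter]
    exact ⟨fun h => h.2, fun h => ⟨hS ω ω₀ hω₀ h, h⟩⟩

/-! ### Set integrals against the uniform measure are finite sums -/

set_option linter.dupNamespace false in
/-- Every singleton has mass `(n!)⁻¹` under `pairMeasure n = (n!)⁻¹ • count`. -/
private theorem pairMeasure_real_singleton {n : ℕ} (x : TableauPair n) :
    (pairMeasure n).real {x} = ((n.factorial : ℝ))⁻¹ := by
  rw [measureReal_def, pairMeasure, Measure.smul_apply, Measure.count_singleton, smul_eq_mul, mul_one,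
    ENNReal.toReal_inv, ENNReal.toReal_natCast]

set_option linter.dupNamespace false in
/-- A set integral against the uniform measure on the finite type `TableauPair n` is the finite sum
`(n!)⁻¹ · ∑_{x ∈ s} F x`. -/
private theorem setIntegral_pairMeasure {n : ℕ} (s : Set (TableauPair n)) (F : TableauPair n → ℝ) :
    ∫ x in s, F x ∂(pairMeasure n) = ((n.factorial : ℝ))⁻¹ * ∑ x ∈ (Set.toFinite s).toFinset, F x := by
  haveI : IsProbabilityMeasure (pairMeasure n) := (pairMeasure_basic n).1
  have h := setIntegral_finset (μ := pairMeasure n) (Set.toFinite s).toFinset (f := F)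
    Integrable.of_finite.integrableOn
  rw [Set.Finite.coe_toFinset] at h
  rw [h, Finset.mul_sum]
  refine Finset.sum_congr rfl fun x _ => ?_
  rw [pairMeasure_real_singleton, smul_eq_mul]

/-! ### The theorem -/

set_option linter.dupNamespace false in
/-- **Model theorem: the conditional law of the next shape given the prefix filtration is the Plancherel kernel**
(stub `condExp_prefix_succ` of line `klr-graded-polynomial-method`, crux `SnSubsetDichotomy.NoThresholdSubsetTriple`).
Under the uniform measure on the same-shape tableau pairs `TableauPair n`, for `t < n` and every test function `φ` of
the shape, `E[φ(ν_{t+1}) | ℱ_t] = ∑_{z addable in ν_t} transProb ν_t z · φ(ν_t ∪ {z})` almost everywhere, where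
`ν_t(ω) = shapeBefore (ω.2.2).1 t` is the shape of the entries `< t` of the second tableau and `ℱ_t = prefixFiltration n t`
is generated by their cells: the prefix-shape process is the Plancherel growth process.  (Uniqueness of the conditional
expectation: the right-hand side is `ℱ_t`-measurable, and its integral over every `ℱ_t`-set — a union of prefix blocks —
equals that of `φ(ν_{t+1})`, block by block, by the counting form `block_succ_card`.) -/
theorem condExp_prefix_succ : ∀ (n t : ℕ), t < n → ∀ (φ : Finset (ℕ × ℕ) → ℝ),
    (pairMeasure n)[fun ω : TableauPair n => φ (shapeBefore (ω.2.2).1 (t + 1)) | prefixFiltration n t] =ᵐ[pairMeasure n]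
      fun ω => ∑ z ∈ addableNodes (shapeBefore (ω.2.2).1 t),
        transProb (shapeBefore (ω.2.2).1 t) z * φ (insert z (shapeBefore (ω.2.2).1 t)) := by
  intro n t ht φ
  haveI : IsProbabilityMeasure (pairMeasure n) := (pairMeasure_basic n).1
  refine (ae_eq_condExp_of_forall_setIntegral_eq ((prefixFiltration n).le t) Integrable.of_finite
    (fun s _ _ => Integrable.of_finite.integrableOn) (fun s hs _ => ?_)
    ((pairMeasure_basic n).2.2 t fun Y =>
      ∑ z ∈ addableNodes Y, transProb Y z * φ (insert z Y)).aestronglyMeasurable).symm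
  -- an `ℱ_t`-measurable set is the preimage of a set of keys, hence saturated for the prefix key
  obtain ⟨A, -, rfl⟩ := MeasurableSpace.measurableSet_comap.1 hs
  rw [setIntegral_pairMeasure, setIntegral_pairMeasure]
  congr 1
  refine (sum_saturated_eq ht φ _ fun ω ω₀ hω₀ h => ?_).symm
  rw [Set.Finite.mem_toFinset, Set.mem_preimage] at hω₀ ⊢
  rw [h]
  exact hω₀

end Summit.MatrixMultiplication.MatrixMultiplication.Theorems
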